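import Mathlib
import Summits.Ventures.PercRepro2.TypedSmallVertexReduction
import Summits.Ventures.PercRepro2.TypedSixVertex
import Summits.Ventures.PercRepro2.TypedBundleSpine

/-!
# The two exact part rules on the class with at most two unmarked typed vertices: root bundles
and two-terminal parts are theorems there, and the seven-vertex hypothesis without them (blind
cell PercRepro2, mine-2 g43, 2026-08-29; `proofs/MINE2-SEVEN.md` §5, row M2-88)

p2's two exact elimination identities — the root bundle (`typedCount_rootBundle`: an unmarked part
`I` hanging on `v, a₁, a₂` becomes the two virtual edges `v–a₁(k₁)`, `v–a₂(k₂)`) and the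
two-terminal part (`typedCount_twoTerminal`: a part attached at `s, t` becomes the virtual edge
`s–t(k)`) — write the typed count as a nonnegative integer combination of counts of instances with
one part fewer.  On the class «at most two unmarked typed vertices» (the residual class of the
seven-vertex reduction `HCov_of_card_le_seven_of_residual`), the instances after the elimination
have at most one unmarked typed vertex whenever the part is TOUCHED (some typed edge of the part
meets `I`) and its third terminal `v` is a mark or touched — and those are theorems of the tree
(`typedCount_nonneg_of_unmarked_le_one`, TypedSixVertex.lean; the virtual types `0` / `3` pinned
by `typedCount_mixed_of_le_three`).

* **`typedCount_nonneg_of_rootBundle_rest_le_one'`**, **`typedCount_nonneg_of_twoTerminal_rest_le_one`**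
  — the compositions, every pinning;
* **`RootBundleTouched`**, **`TwoTerminalMarked`** — the touched root bundle (`v` a mark or touched)
  and the two-terminal part with marked terminals, touched;
* **`typedCount_nonneg_of_rootBundleTouched_unmarked_le_two`**,
  **`typedCount_nonneg_of_twoTerminalMarked_unmarked_le_two`** — row 2′TRI on any pinned-closed
  instance with at most two unmarked typed vertices carrying such a part;
* **`HCov_of_card_le_seven_of_residual_core`** — (HCOV) on every graph with at most seven vertices
  from row 2′TRI on the residual instances with at most two unmarked typed vertices carrying
  NEITHER a touched root bundle NOR a marked two-terminal part: the hats, the adjacent pairs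
  `u ~ {a₁, a₂, w}`, the pairs hanging on the roots and a mark, and the pairs attached at two
  marks are removed from the seven-vertex hypothesis.

Own code; standard axioms.
-/

namespace Summit.Ventures.PercRepro2

open UnionCluster

namespace CovForm

namespace TypedRed

open RootBundle TwoTerm

/-! ## The virtual instances have the rest's unmarked typed vertices, plus the terminals -/

section Virtual

variable {V : Type*} {E : Type*} [Fintype V] [DecidableEq V] [DecidableEq E]

/-- Two virtual edges `h₁ ↦ v–a₁`, `h₂ ↦ v–a₂` on the rest `F \ L`: the unmarked typed vertices are
those of the rest, plus `v` when unmarked. -/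
lemma unmarkedTyped_virtual2_subset (ends : E → Sym2 V) (o a₁ a₂ a₃ b v : V) (F L : Finset E)
    {h₁ h₂ : E} (h₁L : h₁ ∈ L) (h₂L : h₂ ∈ L) (h12 : h₁ ≠ h₂) (τ' : E → ℕ) :
    unmarkedTyped (Function.update (Function.update ends h₁ s(v, a₁)) h₂ s(v, a₂)) o a₁ a₂ a₃ b
        (mixedPart (insert h₂ (insert h₁ (F \ L))) τ') ⊆
      unmarkedTyped ends o a₁ a₂ a₃ b (F \ L) ∪ ({v} \ markSet o a₁ a₂ a₃ b) := by
  intro x hx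
  rw [mem_unmarkedTyped] at hx
  obtain ⟨⟨e, he, hxe⟩, hxo, hx1, hx2, hx3, hxb⟩ := hx
  obtain ⟨he, -⟩ := mem_mixedPart.1 he
  rw [Finset.mem_union, mem_unmarkedTyped, Finset.mem_sdiff, Finset.mem_singleton, mem_markSet]
  rcases Finset.mem_insert.1 he with rfl | he
  · rw [Function.update_self] at hxe
    rcases Sym2.mem_iff.1 hxe with rfl | rfl
    · refine Or.inr ⟨rfl, ?_⟩
      rintro (h | h | h | h | h)
      · exact hxo h
      · exact hx1 h
      · exact hx2 h
      · exact hx3 h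
      · exact hxb h
    · exact absurd rfl hx2
  · rcases Finset.mem_insert.1 he with rfl | he
    · rw [Function.update_of_ne h12, Function.update_self] at hxe
      rcases Sym2.mem_iff.1 hxe with rfl | rfl
      · refine Or.inr ⟨rfl, ?_⟩
        rintro (h | h | h | h | h)
        · exact hxo h
        · exact hx1 h
        · exact hx2 h
        · exact hx3 h
        · exact hxb h
      · exact absurd rfl hx1
    · have hne1 : e ≠ h₁ := fun h => (Finset.mem_sdiff.1 he).2 (h ▸ h₁L)
      have hne2 : e ≠ h₂ := fun h => (Finset.mem_sdiff.1 he).2 (h ▸ h₂L)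
      rw [Function.update_of_ne hne2, Function.update_of_ne hne1] at hxe
      exact Or.inl ⟨⟨e, he, hxe⟩, hxo, hx1, hx2, hx3, hxb⟩

/-- One virtual edge `h₀ ↦ s–t` on the rest `F \ L`: the unmarked typed vertices are those of the
rest, plus the unmarked terminals. -/
lemma unmarkedTyped_virtual1_subset (ends : E → Sym2 V) (o a₁ a₂ a₃ b s t : V) (F L : Finset E)
    {h₀ : E} (h₀L : h₀ ∈ L) (τ' : E → ℕ) :
    unmarkedTyped (Function.update ends h₀ s(s, t)) o a₁ a₂ a₃ b
        (mixedPart (insert h₀ (F \ L)) τ') ⊆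
      unmarkedTyped ends o a₁ a₂ a₃ b (F \ L) ∪ ({s, t} \ markSet o a₁ a₂ a₃ b) := by
  intro x hx
  rw [mem_unmarkedTyped] at hx
  obtain ⟨⟨e, he, hxe⟩, hxo, hx1, hx2, hx3, hxb⟩ := hx
  obtain ⟨he, -⟩ := mem_mixedPart.1 he
  rw [Finset.mem_union, mem_unmarkedTyped, Finset.mem_sdiff, Finset.mem_insert,
    Finset.mem_singleton, mem_markSet]
  rcases Finset.mem_insert.1 he with rfl | he
  · rw [Function.update_self] at hxe
    have hnm : ¬ (x = o ∨ x = a₁ ∨ x = a₂ ∨ x = a₃ ∨ x = b) := by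
      rintro (h | h | h | h | h)
      · exact hxo h
      · exact hx1 h
      · exact hx2 h
      · exact hx3 h
      · exact hxb h
    rcases Sym2.mem_iff.1 hxe with rfl | rfl
    · exact Or.inr ⟨Or.inl rfl, hnm⟩
    · exact Or.inr ⟨Or.inr rfl, hnm⟩
  · have hne : e ≠ h₀ := fun h => (Finset.mem_sdiff.1 he).2 (h ▸ h₀L)
    rw [Function.update_of_ne hne] at hxe
    exact Or.inl ⟨⟨e, he, hxe⟩, hxo, hx1, hx2, hx3, hxb⟩

end Virtual

/-! ## The two compositions -/

section Compose

variable {V : Type*} {E : Type*} [Fintype V] [DecidableEq V] [Fintype E] [DecidableEq E]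
variable {R : Type*} [Field R] [LinearOrder R] [IsStrictOrderedRing R]

/-- **The root-bundle composition**: a root bundle whose rest (with `v` when unmarked) has at most
one unmarked typed vertex has nonnegative typed count, for every pinning. -/
theorem typedCount_nonneg_of_rootBundle_rest_le_one' (ends : E → Sym2 V) (o a₁ a₂ a₃ b : V)
    {I : Set V} {v : V} (hv : v ∉ I) (hI : ∀ x ∈ I, x ≠ o ∧ x ≠ a₁ ∧ x ≠ a₂ ∧ x ≠ a₃ ∧ x ≠ b)
    {L : Finset E} (hLI : ∀ e ∈ L, ∀ x ∈ ends e, x ∈ I ∨ x = v ∨ x = a₁ ∨ x = a₂)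
    {h₁ h₂ : E} (h₁L : h₁ ∈ L) (h₂L : h₂ ∈ L) (h12 : h₁ ≠ h₂) {F : Finset E} (hLF : L ⊆ F)
    (z : Config E) (τ : E → ℕ) (hτ : ∀ e ∈ F, τ e = 1 ∨ τ e = 2)
    (hcl : ∀ e, e ∉ L → (∃ x ∈ I, x ∈ ends e) → e ∉ F ∧ z e = false)
    (hrest : (unmarkedTyped ends o a₁ a₂ a₃ b (F \ L) ∪ ({v} \ markSet o a₁ a₂ a₃ b)).card ≤ 1) :
    0 ≤ typedCount F z τ (K3 ends o a₁ a₂ a₃ b : Config E → Config E → Config E → R) := by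
  refine typedCount_nonneg_of_rootBundle ends o a₁ a₂ a₃ b hv hI hLI h₁L h₂L h12 hLF z τ hcl ?_
  intro k₁ k₂ hk₁ hk₂
  have hh₁ : h₁ ∉ F \ L := fun h => (Finset.mem_sdiff.1 h).2 h₁L
  have hh₂ : h₂ ∉ insert h₁ (F \ L) := by
    rw [Finset.mem_insert, not_or]
    exact ⟨Ne.symm h12, fun h => (Finset.mem_sdiff.1 h).2 h₂L⟩
  have hτ3 : ∀ e ∈ insert h₂ (insert h₁ (F \ L)),
      Function.update (Function.update τ h₁ k₁) h₂ k₂ e ≤ 3 := by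
    intro e he
    rcases Finset.mem_insert.1 he with rfl | he
    · rw [Function.update_self]; exact hk₂
    · rw [Function.update_of_ne (fun h => hh₂ (by rw [← h]; exact he))]
      rcases Finset.mem_insert.1 he with rfl | he
      · rw [Function.update_self]; exact hk₁
      · rw [Function.update_of_ne (fun h => hh₁ (by rw [← h]; exact he))]
        rcases hτ e (Finset.mem_sdiff.1 he).1 with h | h <;> omega
  rw [typedCount_mixed_of_le_three _ _ _ hτ3]
  refine typedCount_nonneg_of_unmarked_le_one _ o a₁ a₂ a₃ b _ _ _
    (fun e he => (mem_mixedPart.1 he).2) ?_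
  exact (Finset.card_le_card
    (unmarkedTyped_virtual2_subset ends o a₁ a₂ a₃ b v F L h₁L h₂L h12 _)).trans hrest

/-- **The two-terminal composition**: a two-terminal part whose rest (with the unmarked terminals)
has at most one unmarked typed vertex has nonnegative typed count, for every pinning. -/
theorem typedCount_nonneg_of_twoTerminal_rest_le_one (ends : E → Sym2 V) (o a₁ a₂ a₃ b : V)
    {I : Set V} {s t : V} (hs : s ∉ I) (ht : t ∉ I)
    (hI : ∀ x ∈ I, x ≠ o ∧ x ≠ a₁ ∧ x ≠ a₂ ∧ x ≠ a₃ ∧ x ≠ b)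
    {L : Finset E} (hLI : ∀ e ∈ L, ∀ x ∈ ends e, x ∈ I ∨ x = s ∨ x = t) {h₀ : E} (h₀L : h₀ ∈ L)
    {F : Finset E} (hLF : L ⊆ F) (z : Config E) (τ : E → ℕ) (hτ : ∀ e ∈ F, τ e = 1 ∨ τ e = 2)
    (hcl : ∀ e, e ∉ L → (∃ x ∈ I, x ∈ ends e) → e ∉ F ∧ z e = false)
    (hrest : (unmarkedTyped ends o a₁ a₂ a₃ b (F \ L) ∪
      ({s, t} \ markSet o a₁ a₂ a₃ b)).card ≤ 1) :
    0 ≤ typedCount F z τ (K3 ends o a₁ a₂ a₃ b : Config E → Config E → Config E → R) := by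
  refine typedCount_nonneg_of_twoTerminal ends o a₁ a₂ a₃ b hs ht hI hLI h₀L hLF z τ hcl ?_
  intro k hk
  have hh₀ : h₀ ∉ F \ L := fun h => (Finset.mem_sdiff.1 h).2 h₀L
  have hτ3 : ∀ e ∈ insert h₀ (F \ L), Function.update τ h₀ k e ≤ 3 := by
    intro e he
    rcases Finset.mem_insert.1 he with rfl | he
    · rw [Function.update_self]; exact hk
    · rw [Function.update_of_ne (fun h => hh₀ (by rw [← h]; exact he))]
      rcases hτ e (Finset.mem_sdiff.1 he).1 with h | h <;> omega
  rw [typedCount_mixed_of_le_three _ _ _ hτ3]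
  refine typedCount_nonneg_of_unmarked_le_one _ o a₁ a₂ a₃ b _ _ _
    (fun e he => (mem_mixedPart.1 he).2) ?_
  exact (Finset.card_le_card
    (unmarkedTyped_virtual1_subset ends o a₁ a₂ a₃ b s t F L h₀L _)).trans hrest

end Compose

/-! ## The parts on the class with at most two unmarked typed vertices -/

section Parts

variable {V : Type*} {E : Type*} [Fintype V] [DecidableEq V] [Fintype E] [DecidableEq E]
variable {R : Type*} [Field R] [LinearOrder R] [IsStrictOrderedRing R]

omit [Fintype V] [DecidableEq V] [Fintype E] in
/-- A TOUCHED root bundle: p2's `RootBundlePart` with some typed edge of the bundle meeting `I`, and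
the third terminal `v` a mark or met by a typed edge of the bundle. -/
def RootBundleTouched (ends : E → Sym2 V) (o a₁ a₂ a₃ b : V) (F : Finset E) (I : Set V) (v : V)
    (L : Finset E) : Prop :=
  RootBundlePart ends o a₁ a₂ a₃ b F I v L ∧ (∃ e ∈ L, ∃ x ∈ I, x ∈ ends e) ∧
    ((v = o ∨ v = a₁ ∨ v = a₂ ∨ v = a₃ ∨ v = b) ∨ ∃ e ∈ L, v ∈ ends e)

omit [Fintype V] [DecidableEq V] [Fintype E] in
/-- A two-terminal part with MARKED terminals, touched: p2's `TwoTerminalPart` with `s, t` marks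
and some typed edge of the part meeting `I`. -/
def TwoTerminalMarked (ends : E → Sym2 V) (o a₁ a₂ a₃ b : V) (F : Finset E) (I : Set V)
    (s t : V) (L : Finset E) : Prop :=
  TwoTerminalPart ends o a₁ a₂ a₃ b F I s t L ∧ (∃ e ∈ L, ∃ x ∈ I, x ∈ ends e) ∧
    (s = o ∨ s = a₁ ∨ s = a₂ ∨ s = a₃ ∨ s = b) ∧ (t = o ∨ t = a₁ ∨ t = a₂ ∨ t = a₃ ∨ t = b)

omit [Fintype E] in
/-- A typed edge `e ∈ L ⊆ F` meeting the part `I` of a closed part: the rest `F \ L` misses `I`,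
so the unmarked typed vertices of the rest lie in those of `F` minus the met vertex. -/
lemma unmarkedTyped_rest_subset_erase (ends : E → Sym2 V) (o a₁ a₂ a₃ b : V) (F L : Finset E)
    {I : Set V} (hI : ∀ x ∈ I, x ≠ o ∧ x ≠ a₁ ∧ x ≠ a₂ ∧ x ≠ a₃ ∧ x ≠ b) (hLF : L ⊆ F)
    (hcl : ∀ e, e ∉ L → (∃ x ∈ I, x ∈ ends e) → e ∉ F) {e₀ : E} (he₀ : e₀ ∈ L) {x₀ : V}
    (hx₀ : x₀ ∈ I) (hx₀e : x₀ ∈ ends e₀) :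
    x₀ ∈ unmarkedTyped ends o a₁ a₂ a₃ b F ∧
      unmarkedTyped ends o a₁ a₂ a₃ b (F \ L) ⊆ (unmarkedTyped ends o a₁ a₂ a₃ b F).erase x₀ := by
  obtain ⟨h0, h1, h2, h3, hb⟩ := hI x₀ hx₀
  refine ⟨mem_unmarkedTyped.2 ⟨⟨e₀, hLF he₀, hx₀e⟩, h0, h1, h2, h3, hb⟩, fun y hy => ?_⟩
  rw [Finset.mem_erase]
  refine ⟨?_, unmarkedTyped_mono Finset.sdiff_subset hy⟩
  rintro rfl
  obtain ⟨⟨e, he, hye⟩, -⟩ := mem_unmarkedTyped.1 hy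
  exact hcl e (Finset.mem_sdiff.1 he).2 ⟨y, hx₀, hye⟩ (Finset.mem_sdiff.1 he).1

/-- **Row 2′TRI on a pinned-closed instance with at most two unmarked typed vertices carrying a
touched root bundle.** -/
theorem typedCount_nonneg_of_rootBundleTouched_unmarked_le_two (ends : E → Sym2 V)
    (o a₁ a₂ a₃ b : V) (F : Finset E) (τ : E → ℕ) (hτ : ∀ e ∈ F, τ e = 1 ∨ τ e = 2)
    (h2 : (unmarkedTyped ends o a₁ a₂ a₃ b F).card ≤ 2) {I : Set V} {v : V} {L : Finset E}
    (hP : RootBundleTouched ends o a₁ a₂ a₃ b F I v L) :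
    0 ≤ typedCount F (fun _ => false) τ
      (K3 ends o a₁ a₂ a₃ b : Config E → Config E → Config E → R) := by
  obtain ⟨hP, ⟨e₀, he₀, x₀, hx₀, hx₀e⟩, hv⟩ := hP
  obtain ⟨h₁, h₁L, h₂, h₂L, h12⟩ : ∃ h₁ ∈ L, ∃ h₂ ∈ L, h₁ ≠ h₂ :=
    Finset.one_lt_card.1 (by have := hP.three_le; omega)
  obtain ⟨hx₀F, hsub⟩ := unmarkedTyped_rest_subset_erase ends o a₁ a₂ a₃ b F L hP.unmarked hP.sub
    hP.closed he₀ hx₀ hx₀e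
  refine typedCount_nonneg_of_rootBundle_rest_le_one' ends o a₁ a₂ a₃ b hP.v_ext hP.unmarked
    hP.ends_in h₁L h₂L h12 hP.sub _ τ hτ (fun e he hx => ⟨hP.closed e he hx, rfl⟩) ?_
  have hsub' : unmarkedTyped ends o a₁ a₂ a₃ b (F \ L) ∪ ({v} \ markSet o a₁ a₂ a₃ b) ⊆
      (unmarkedTyped ends o a₁ a₂ a₃ b F).erase x₀ := by
    intro y hy
    rcases Finset.mem_union.1 hy with hy | hy
    · exact hsub hy
    · rw [Finset.mem_sdiff, Finset.mem_singleton, mem_markSet] at hy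
      obtain ⟨rfl, hym⟩ := hy
      rw [not_or, not_or, not_or, not_or] at hym
      obtain ⟨hyo, hy1, hy2, hy3, hyb⟩ := hym
      rcases hv with hv | ⟨e, he, hye⟩
      · exfalso
        rcases hv with h | h | h | h | h
        · exact hyo h
        · exact hy1 h
        · exact hy2 h
        · exact hy3 h
        · exact hyb h
      · rw [Finset.mem_erase]
        exact ⟨fun h => hP.v_ext (h ▸ hx₀),
          mem_unmarkedTyped.2 ⟨⟨e, hP.sub he, hye⟩, hyo, hy1, hy2, hy3, hyb⟩⟩
  have hcard := Finset.card_le_card hsub'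
  rw [Finset.card_erase_of_mem hx₀F] at hcard
  omega

/-- **Row 2′TRI on a pinned-closed instance with at most two unmarked typed vertices carrying a
marked two-terminal part.** -/
theorem typedCount_nonneg_of_twoTerminalMarked_unmarked_le_two (ends : E → Sym2 V)
    (o a₁ a₂ a₃ b : V) (F : Finset E) (τ : E → ℕ) (hτ : ∀ e ∈ F, τ e = 1 ∨ τ e = 2)
    (h2 : (unmarkedTyped ends o a₁ a₂ a₃ b F).card ≤ 2) {I : Set V} {s t : V} {L : Finset E}
    (hP : TwoTerminalMarked ends o a₁ a₂ a₃ b F I s t L) :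
    0 ≤ typedCount F (fun _ => false) τ
      (K3 ends o a₁ a₂ a₃ b : Config E → Config E → Config E → R) := by
  obtain ⟨hP, ⟨e₀, he₀, x₀, hx₀, hx₀e⟩, hs, ht⟩ := hP
  obtain ⟨h₀, h₀L⟩ : ∃ h₀, h₀ ∈ L := Finset.card_pos.1 (by have := hP.two_le; omega)
  obtain ⟨hx₀F, hsub⟩ := unmarkedTyped_rest_subset_erase ends o a₁ a₂ a₃ b F L hP.unmarked hP.sub
    hP.closed he₀ hx₀ hx₀e
  refine typedCount_nonneg_of_twoTerminal_rest_le_one ends o a₁ a₂ a₃ b hP.s_ext hP.t_ext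
    hP.unmarked hP.ends_in h₀L hP.sub _ τ hτ (fun e he hx => ⟨hP.closed e he hx, rfl⟩) ?_
  have hsub' : unmarkedTyped ends o a₁ a₂ a₃ b (F \ L) ∪ ({s, t} \ markSet o a₁ a₂ a₃ b) ⊆
      (unmarkedTyped ends o a₁ a₂ a₃ b F).erase x₀ := by
    intro y hy
    rcases Finset.mem_union.1 hy with hy | hy
    · exact hsub hy
    · rw [Finset.mem_sdiff, Finset.mem_insert, Finset.mem_singleton, mem_markSet] at hy
      obtain ⟨hy, hym⟩ := hy
      rcases hy with rfl | rfl
      · exact absurd hs hym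
      · exact absurd ht hym
  have hcard := Finset.card_le_card hsub'
  rw [Finset.card_erase_of_mem hx₀F] at hcard
  omega

end Parts

/-! ## The seven-vertex hypothesis without the parts -/

section Seven

variable {V : Type*} {E : Type*} [Fintype V] [DecidableEq V] [Fintype E] [DecidableEq E]
variable {R : Type*} [Field R] [LinearOrder R] [IsStrictOrderedRing R]

/-- **Row 2′TRI on the residual instances with at most two unmarked typed vertices** from those
carrying neither a touched root bundle nor a marked two-terminal part. -/
theorem typedCount_nonneg_of_residual_unmarked_le_two_of_core
    (hNR : ∀ (ends : E → Sym2 V) (o a₁ a₂ a₃ b : V) (F : Finset E) (τ : E → ℕ),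
      (∀ e ∈ F, τ e = 1 ∨ τ e = 2) → Residual ends o a₁ a₂ a₃ b F →
        (unmarkedTyped ends o a₁ a₂ a₃ b F).card ≤ 2 →
        (∀ (I : Set V) (v : V) (L : Finset E), ¬ RootBundleTouched ends o a₁ a₂ a₃ b F I v L) →
        (∀ (I : Set V) (s t : V) (L : Finset E), ¬ TwoTerminalMarked ends o a₁ a₂ a₃ b F I s t L) →
        0 ≤ typedCount F (fun _ => false) τ
          (K3 ends o a₁ a₂ a₃ b : Config E → Config E → Config E → R))
    (ends : E → Sym2 V) (o a₁ a₂ a₃ b : V) (F : Finset E) (τ : E → ℕ)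
    (hτ : ∀ e ∈ F, τ e = 1 ∨ τ e = 2) (hres : Residual ends o a₁ a₂ a₃ b F)
    (h2 : (unmarkedTyped ends o a₁ a₂ a₃ b F).card ≤ 2) :
    0 ≤ typedCount F (fun _ => false) τ
      (K3 ends o a₁ a₂ a₃ b : Config E → Config E → Config E → R) := by
  by_cases hB : ∃ (I : Set V) (v : V) (L : Finset E), RootBundleTouched ends o a₁ a₂ a₃ b F I v L
  · obtain ⟨I, v, L, hP⟩ := hB
    exact typedCount_nonneg_of_rootBundleTouched_unmarked_le_two ends o a₁ a₂ a₃ b F τ hτ h2 hP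
  by_cases hT : ∃ (I : Set V) (s t : V) (L : Finset E), TwoTerminalMarked ends o a₁ a₂ a₃ b F I s t L
  · obtain ⟨I, s, t, L, hP⟩ := hT
    exact typedCount_nonneg_of_twoTerminalMarked_unmarked_le_two ends o a₁ a₂ a₃ b F τ hτ h2 hP
  exact hNR ends o a₁ a₂ a₃ b F τ hτ hres h2 (fun I v L h => hB ⟨I, v, L, h⟩)
    (fun I s t L h => hT ⟨I, s, t, L, h⟩)

/-- **Seven vertices, the parts removed**: (HCOV) on every graph with at most seven vertices and
five distinct marks follows from row 2′TRI on the residual instances with at most two unmarked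
typed vertices carrying neither a touched root bundle nor a marked two-terminal part. -/
theorem HCov_of_card_le_seven_of_residual_core
    (hNR : ∀ (ends : E → Sym2 V) (o a₁ a₂ a₃ b : V) (F : Finset E) (τ : E → ℕ),
      (∀ e ∈ F, τ e = 1 ∨ τ e = 2) → Residual ends o a₁ a₂ a₃ b F →
        (unmarkedTyped ends o a₁ a₂ a₃ b F).card ≤ 2 →
        (∀ (I : Set V) (v : V) (L : Finset E), ¬ RootBundleTouched ends o a₁ a₂ a₃ b F I v L) →
        (∀ (I : Set V) (s t : V) (L : Finset E), ¬ TwoTerminalMarked ends o a₁ a₂ a₃ b F I s t L) →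
        0 ≤ typedCount F (fun _ => false) τ
          (K3 ends o a₁ a₂ a₃ b : Config E → Config E → Config E → R))
    (ends : E → Sym2 V) (p : E → R) (hp : IsProbVec p) (o a₁ a₂ a₃ b : V)
    (hV : Fintype.card V ≤ 7) (h12 : a₁ ≠ a₂) (h13 : a₁ ≠ a₃) (h23 : a₂ ≠ a₃) (ho1 : o ≠ a₁)
    (ho2 : o ≠ a₂) (ho3 : o ≠ a₃) (hob : o ≠ b) (hb1 : b ≠ a₁) (hb2 : b ≠ a₂) (hb3 : b ≠ a₃) :
    HCov p ends o a₁ a₂ a₃ b :=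
  HCov_of_card_le_seven_of_residual
    (fun ends o a₁ a₂ a₃ b F τ hτ hres h2 =>
      typedCount_nonneg_of_residual_unmarked_le_two_of_core hNR ends o a₁ a₂ a₃ b F τ hτ hres h2)
    ends p hp o a₁ a₂ a₃ b hV h12 h13 h23 ho1 ho2 ho3 hob hb1 hb2 hb3

end Seven

end TypedRed

end CovForm

end Summit.Ventures.PercRepro2
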